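import Summits.Ventures.Crystal3D.Theorems.StickyWulffConstantPolycrystalWulffBoundRungSuperTree

/-!
# `PolycrystalWulffBound`, line `PolyDensity`: single-axis twin textures with a HEIGHT-LOCAL choice of the
# slide direction (`rung_singleAxis_slabs`; crux `stmt-Ventures-19482`)

Route `StickyWulffConstant` of the venture `Summits/Ventures/Crystal3D`, second prover lane (poly-p2,
gen 13).  A corollary of the tree-of-super-grains rung (`rung_superTree_cells`) that sharpens the general
single-axis rung (`rung_singleAxis_cells`, gen 10): there ONE horizontal `⟨112⟩` direction `w` served the
whole texture, so a texture whose twin walls are balanced over the three azimuth classes (the A/B/A/B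
stacks with three differently tilted walls, residual (P-R1) of gen 11) failed the aggregate test.  Cut the
texture by BASAL planes `{⟪x, m⟫ = cut i}` (`δ`-spaced) into horizontal SLABS and let every slab choose
its OWN `⟨112⟩` direction `wS`: the slabs are the nodes of a path-shaped sorted tree, the cut faces are
free edges (same lattice, or coherent basal twin walls; normal `m ⊥` every horizontal `w`; one reference
frame `A₀` for all slabs, so the profile condition is `rfl`), and `rung_superTree_cells` gives
`6·2^{1/3}(√2·Vol)^{2/3} ≤ Fr + (1/√6)·Σ_{same slab, τ ≠ τ'} |⟪wS slab, ν⟫|·facetArea`.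
So the azimuth test is needed only WITHIN A HORIZONTAL SLAB: differently tilted twin walls at different
heights each get their best direction (`≤ (1/√6)·sin∠ < ½·sin∠` per wall); what remains of the
single-axis residual at the law `½` is azimuth balance inside one horizontal section (junction lines, the
`W_min` centre cones).
WHAT THIS IS NOT: the cutting itself (the cells are assumed presented slab by slab); the crux is not claimed.
-/

noncomputable section

open scoped BigOperators InnerProductSpace ENNReal Pointwise
open MeasureTheory Filter Set

namespace Summit.Ventures.Crystal3D.Cruxes.PolycrystalWulffBound.PolyDensity

open Summit.Ventures.Crystal3D.Theorems
open Summit.Ventures.Crystal3D.Cruxes.TextureLiminf.TexShadow (per polytope E3 facetArea)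
open Literature.MathematicalPhysics.StatisticalMechanics (fccStacking barlowStacking IsHaggSeq perimeter)

/-- **Rung `rung_singleAxis_slabs`**: a single-axis twin texture presented by cells sorted into `δ`-spaced
horizontal slabs (slab `i.succ` above the plane `⟪x, m⟫ = cut i`, slab `i.castSucc` below it), all frames
co-axial with `A₀` about `m`, one (bond, `⟨112⟩`) pair `(uS F, wS F)` PER SLAB ⇒
`6·2^{1/3}(√2·Vol)^{2/3} ≤ Fr + (1/√6)·Σ_{sl j = sl j', τ j ≠ τ j'} |⟪wS (sl j), ν_{jj'}⟫|·facetArea`. -/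
theorem rung_singleAxis_slabs : let Λ : Set (EuclideanSpace ℝ (Fin 3)) := Literature.MathematicalPhysics.StatisticalMechanics.fccStacking 1 (Real.sqrt (2 / 3)); let Brl : (ℤ → ℤ) → Set (EuclideanSpace ℝ (Fin 3)) := Literature.MathematicalPhysics.StatisticalMechanics.barlowStacking 1 (Real.sqrt (2 / 3)); let Ax : EuclideanSpace ℝ (Fin 3) → (EuclideanSpace ℝ (Fin 3) ≃ₗᵢ[ℝ] EuclideanSpace ℝ (Fin 3)) → (EuclideanSpace ℝ (Fin 3) ≃ₗᵢ[ℝ] EuclideanSpace ℝ (Fin 3)) → Prop := fun m A B => ∃ (L : EuclideanSpace ℝ (Fin 3) ≃ₗᵢ[ℝ] EuclideanSpace ℝ (Fin 3)) (s₁ s₂ : EuclideanSpace ℝ (Fin 3)) (σ σ' : ℤ → ℤ), Literature.MathematicalPhysics.StatisticalMechanics.IsHaggSeq σ ∧ Literature.MathematicalPhysics.StatisticalMechanics.IsHaggSeq σ' ∧ L (EuclideanSpace.single (2 : Fin 3) (1 : ℝ)) = m ∧ A '' Λ ⊆ (fun q => L q + s₁) '' Brl σ ∧ B '' Λ ⊆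 (fun q => L q + s₂) '' Brl σ'; let Φ : EuclideanSpace ℝ (Fin 3) → ℝ := fun ν => Real.sqrt 2 / 4 * ∑ᶠ w ∈ {w ∈ Λ | ‖w‖ = 1}, |⟪w, ν⟫_ℝ|; let Per : Set (EuclideanSpace ℝ (Fin 3)) → Set (EuclideanSpace ℝ (Fin 3)) → ℝ := fun K S => (⨆ (ξ : EuclideanSpace ℝ (Fin 3) → EuclideanSpace ℝ (Fin 3)) (_ : ContDiff ℝ 1 ξ ∧ HasCompactSupport ξ ∧ ∀ z, ξ z ∈ K), ENNReal.ofReal (∫ z in S, Literature.MathematicalPhysics.StatisticalMechanics.fieldDivergence ξ z)).toReal; let ι : Set (EuclideanSpace ℝ (Fin 3)) → Set (EuclideanSpace ℝ (Fin 3)) → Set (EuclideanSpace ℝ (Fin 3)) → ℝ := fun K S₁ S₂ => (Per K S₁ + Per K S₂ - Per K (S₁ ∪ S₂)) / 2; let W : (EuclideanSpace ℝ (Fin 3) ≃ₗᵢ[ℝ] EuclideanSpace ℝ (Fin 3)) → Set (EuclideanSpace ℝ (Fin 3)) := fun A => {y | ∀ ν : EuclideanSpace ℝ (Fin 3), ⟪y,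 ν⟫_ℝ ≤ Φ (A.symm ν)}; let Vol : (n : ℕ) → (Fin n → Set (EuclideanSpace ℝ (Fin 3))) → ℝ := fun n G => (volume (⋃ f : Fin n, G f)).toReal; let Fr : (n : ℕ) → (Fin n → Set (EuclideanSpace ℝ (Fin 3))) → (Fin n → (EuclideanSpace ℝ (Fin 3) ≃ₗᵢ[ℝ] EuclideanSpace ℝ (Fin 3))) → ℝ := fun n G A => ∑ f : Fin n, Per (W (A f)) (G f) - ∑ f, ∑ g, (if f = g then 0 else ι (W (A f)) (G f) (G g)); ∀ (k : ℕ) (H : Fin k → Finset ((EuclideanSpace ℝ (Fin 3)) × ℝ)), let Q : Fin k → Set (EuclideanSpace ℝ (Fin 3)) := fun j => ⋂ p ∈ H j, {x : EuclideanSpace ℝ (Fin 3) | ⟪p.1, x⟫_ℝ < p.2}; ∀ (A : Fin k → (EuclideanSpace ℝ (Fin 3) ≃ₗᵢ[ℝ] EuclideanSpace ℝ (Fin 3))) (nv : Fin k → Fin k → EuclideanSpace ℝ (Fin 3)) (τ : Fin k → Bool) (N : ℕ) (cut : Fin N → ℝ) (sl : Fin k → Fin (N + 1)) (A₀ : EuclideanSpace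 ℝ (Fin 3) ≃ₗᵢ[ℝ] EuclideanSpace ℝ (Fin 3)) (m : EuclideanSpace ℝ (Fin 3)) (uS wS : Fin (N + 1) → EuclideanSpace ℝ (Fin 3)) (δ : ℝ), (∀ j, Bornology.IsBounded (Q j)) → (∀ j j', j ≠ j' → Disjoint (Q j) (Q j')) → (∀ i j, nv j i = -nv i j) → (∀ j j', j ≠ j' → ‖nv j j'‖ = 1 ∧ ∃ b : ℝ, closure (Q j) ∩ closure (Q j') ⊆ {x | ⟪nv j j', x⟫_ℝ = b}) → ‖m‖ = 1 → 0 < δ → (∀ i i' : Fin N, i < i' → cut i + δ ≤ cut i') → (∀ (i : Fin N) j, sl j = i.succ → ∀ x ∈ Q j, cut i < ⟪x, m⟫_ℝ) → (∀ (i : Fin N) j, sl j = i.castSucc → ∀ x ∈ Q j, ⟪x, m⟫_ℝ < cut i) → (∀ j, Ax m A₀ (A j)) → (∀ F, ‖uS F‖ = 1 ∧ ‖wS F‖ = 1 ∧ ⟪uS F, m⟫_ℝ = 0 ∧ ⟪wS F, m⟫_ℝ = 0 ∧ ⟪wS F, uS F⟫_ℝ = 0) → (∀ F, uS F ∈ A₀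 '' Λ ∧ (ℝ ∙ uS F)ᗮ.reflection '' (A₀ '' Λ) = A₀ '' Λ) → (∀ j j', τ j = τ j' → W (A j) = W (A j')) → 6 * (2 : ℝ) ^ ((1 : ℝ) / 3) * (Real.sqrt 2 * Vol k Q) ^ ((2 : ℝ) / 3) ≤ Fr k Q A + 1 / Real.sqrt 6 * ∑ j, ∑ j', (if (sl j = sl j' ∧ τ j ≠ τ j') then |⟪wS (sl j), nv j j'⟫_ℝ| * facetArea (closure (Q j) ∩ closure (Q j')) (nv j j') else 0) := by
  intro Λ Brl Ax Φ Per ι W Vol Fr k H Q A nv τ N cut sl A₀ m uS wS δ hbd hdisj hanti hplane hm hδ hcut hup hdown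
    hAx hON hBM hτ
  -- the path-shaped tree of slabs
  have hR := rung_superTree_cells k H A nv τ N (fun i => i.castSucc) (fun _ => m) cut sl (fun _ => A₀)
    (fun _ => true) (fun _ => m) uS wS δ hbd hdisj hanti hplane (fun i => le_of_eq (Fin.val_castSucc i))
    (fun _ => hm) (fun _ _ => rfl) hup hδ (fun i j hj x hx => Or.inl (hdown i j hj x hx)) ?_
    (fun j h => Bool.noConfusion h) (fun j _ => hAx j) (fun F _ => hON F) (fun F _ => hBM F)
    (fun j j' _ h => hτ j j' h)
    (fun i _ => by rw [real_inner_comm]; exact (hON _).2.2.2.1)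
    (fun i _ => by rw [real_inner_comm]; exact (hON _).2.2.2.1)
  · simp only [true_and] at hR
    exact hR
  -- cells of non-adjacent slabs are `δ`-apart along `m`
  intro j j' hne h1 h2 x hx y hy
  have key : ∀ (a b : Fin k) (F F' : Fin (N + 1)), sl a = F → sl b = F' → (F : ℕ) + 2 ≤ F' →
      ∀ p ∈ Q a, ∀ q ∈ Q b, δ ≤ dist p q := by
    intro a b F F' ha hb hFF p hp q hq
    have hF : (F : ℕ) < N := by have := F'.isLt; omega
    have hF' : 1 ≤ (F' : ℕ) := by omega
    set i : Fin N := ⟨F, hF⟩ with hi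
    set i' : Fin N := ⟨(F' : ℕ) - 1, by have := F'.isLt; omega⟩ with hi'
    have hii' : i < i' := by
      rw [Fin.lt_def]; show (F : ℕ) < (F' : ℕ) - 1; omega
    have hslab_a : sl a = i.castSucc := by rw [ha]; ext; simp [hi]
    have hslab_b : sl b = i'.succ := by rw [hb]; ext; simp [hi']; omega
    have h1 : ⟪p, m⟫_ℝ < cut i := hdown i a hslab_a p hp
    have h2 : cut i' < ⟪q, m⟫_ℝ := hup i' b hslab_b q hq
    have h3 : cut i + δ ≤ cut i' := hcut i i' hii'
    have h4 : ⟪q - p, m⟫_ℝ ≤ ‖q - p‖ := by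
      have := real_inner_le_norm (q - p) m
      rw [hm, mul_one] at this
      exact this
    rw [inner_sub_left] at h4
    rw [dist_comm, dist_eq_norm]
    linarith
  -- which slab is higher
  rcases lt_or_gt_of_ne (fun h : (sl j : ℕ) = sl j' => hne (Fin.ext h)) with hlt | hlt
  · -- `sl j < sl j'`: not adjacent ⇒ `sl j + 2 ≤ sl j'`
    have h2' : (sl j : ℕ) + 2 ≤ sl j' := by
      by_contra hcon
      have heq : (sl j' : ℕ) = sl j + 1 := by omega
      have hF : (sl j : ℕ) < N := by have := (sl j').isLt; omega
      refine h1 ⟨sl j, hF⟩ ⟨?_, ?_⟩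
      · ext; simp
      · ext; simp [heq]
    exact key j j' (sl j) (sl j') rfl rfl h2' x hx y hy
  · have h2' : (sl j' : ℕ) + 2 ≤ sl j := by
      by_contra hcon
      have heq : (sl j : ℕ) = sl j' + 1 := by omega
      have hF : (sl j' : ℕ) < N := by have := (sl j).isLt; omega
      refine h2 ⟨sl j', hF⟩ ⟨?_, ?_⟩
      · ext; simp
      · ext; simp [heq]
    rw [dist_comm]
    exact key j' j (sl j') (sl j) rfl rfl h2' y hy x hx

end Summit.Ventures.Crystal3D.Cruxes.PolycrystalWulffBound.PolyDensity

end
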